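import Summits.HodgeConjecture.FermatCycles.ThreefoldConditionR
import HarnessLib

/-!
# Fermat cycles — complete residual lists for Shioda's condition `(R³ₘ)` at `m = 19, 21` (kernel exhaustion; companion of `ThreefoldConditionR`)

HONEST FRAMING: explicit algebraic cycles for specific Hodge classes on Fermat/Delsarte varieties;
residual open instances listed; no claim on general Hodge.

For each listed level `m` the COMPLETE list, up to units, of the elements of Shioda's set `I` (level-one characters of the Fermat threefold
`X³ₘ`) that are neither decomposable nor quasi-decomposable (`ResidualWithin m reps`), and for each representative that it lies in `I` and is
neither (`…_spec`). Same machinery as `ThreefoldConditionR` (`residualWithin_of_chunks`, kernel `decide` over chunks of first representatives).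
These lists are the arithmetic input R1 of the cell's refereeable note `run/shared/lean/pub/pub-hfermat/pub-hfermat-lit/GHC3-NOTE.md`
(G-Hodge(X³ₘ, F′¹H³) by P-split pencils / uniruled quotients for `m ≤ 21, 23, 24, 29, 31`; two driver implementations), where every listed
representative carries a certificate; the lists agree with four independent enumerations (lit impl-1/impl-2, referee impl-49, lit-g8
`code/lit/ghc3b`). Nothing geometric is asserted here.

References: [Shioda1983WhatIsKnown] T. Shioda, Adv. Stud. Pure Math. 1 (1983), (13) pp. 63–64; cell files as above.
-/

namespace Summit.HodgeConjecture.FermatCycles.ThreefoldResidualA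

open Multiset
open Literature.AlgebraicGeometry.Shioda1982 Literature.AlgebraicGeometry.Shioda1983
open Summit.HodgeConjecture.FermatCycles.ThreefoldConditionR (cover_one)

/-- residual representatives at `m = 19` (9 unit orbits; census `|I| = 702`, `540` decomposable, `0` quasi-decomposable only, `162` residual multisets). [folklore] -/
def residualReps_nineteen : List (Multiset (ZMod 19)) :=
  [{1, 1, 6, 14, 16}, {1, 1, 9, 11, 16}, {1, 1, 9, 12, 15}, {1, 2, 6, 14, 15}, {1, 2, 8, 12, 15}, {1, 2, 9, 11, 15}, {1, 3, 4, 13, 17}, {1, 3, 8, 12, 14}, {1, 4, 5, 11, 17}]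

set_option maxHeartbeats 0 in
/-- the search at `19`, first representatives `a ∈ [1, 5)`. Kernel. [folklore] -/
theorem check_19_1 : checkP 19 (fun s ↦ IsDecomposable s ∨ IsQuasiDecomposable s ∨ ∃ r ∈ residualReps_nineteen, ∃ t ∈ unitsList 19, s = r.map (fun x ↦ (t : ZMod 19) * x)) 1 4 = true := by
  decide +kernel

set_option maxHeartbeats 0 in
/-- the search at `19`, first representatives `a ∈ [5, 19)`. Kernel. [folklore] -/
theorem check_19_5 : checkP 19 (fun s ↦ IsDecomposable s ∨ IsQuasiDecomposable s ∨ ∃ r ∈ residualReps_nineteen, ∃ t ∈ unitsList 19, s = r.map (fun x ↦ (t : ZMod 19) * x)) 5 14 = true := by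
  decide +kernel

/-- **Residual list at `m = 19` is complete**: every element of `I_{19}` is decomposable, quasi-decomposable, or a unit multiple of a listed representative. Kernel exhaustion, 2 chunks. [folklore] -/
theorem residual_nineteen : ResidualWithin 19 residualReps_nineteen :=
  residualWithin_of_chunks 19 _ [(1, 4), (5, 14)] (by
    intro a h0 h1
    rcases Nat.lt_or_ge a 5 with hc0 | hc0
    · exact ⟨(1, 4), by simp, by omega, by omega⟩
    exact ⟨(5, 14), by simp, by omega, by omega⟩) (by
    intro p hp
    simp only [List.mem_cons, List.not_mem_nil, or_false] at hp
    rcases hp with rfl | rfl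
    · exact check_19_1
    · exact check_19_5)

set_option maxHeartbeats 0 in
/-- the representatives at `m = 19` lie in `I` and are neither decomposable nor quasi-decomposable. Kernel. [folklore] -/
theorem residualReps_nineteen_spec :
    ∀ r ∈ residualReps_nineteen, IsLevelOne r ∧ ¬ IsDecomposable r ∧ ¬ IsQuasiDecomposable r := by
  decide +kernel

/-- residual representatives at `m = 21` (12 unit orbits; census `|I| = 1238`, `740` decomposable, `366` quasi-decomposable only, `132` residual multisets). [folklore] -/
def residualReps_twentyOne : List (Multiset (ZMod 21)) :=
  [{1, 3, 5, 14, 19}, {1, 3, 9, 14, 15}, {1, 3, 10, 14, 14}, {1, 4, 7, 15, 15}, {1, 4, 9, 14, 14}, {1, 4, 10, 13, 14}, {1, 5, 8, 9, 19}, {1, 5, 8, 14, 14}, {1, 6, 7, 9, 19}, {1, 7, 7, 9, 18}, {1, 7, 7, 12, 15}, {1, 12, 14, 18, 18}]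

set_option maxHeartbeats 0 in
/-- the search at `21`, first representatives `a ∈ [1, 3)`. Kernel. [folklore] -/
theorem check_21_1 : checkP 21 (fun s ↦ IsDecomposable s ∨ IsQuasiDecomposable s ∨ ∃ r ∈ residualReps_twentyOne, ∃ t ∈ unitsList 21, s = r.map (fun x ↦ (t : ZMod 21) * x)) 1 2 = true := by
  decide +kernel

set_option maxHeartbeats 0 in
/-- the search at `21`, first representatives `a ∈ [3, 7)`. Kernel. [folklore] -/
theorem check_21_3 : checkP 21 (fun s ↦ IsDecomposable s ∨ IsQuasiDecomposable s ∨ ∃ r ∈ residualReps_twentyOne, ∃ t ∈ unitsList 21, s = r.map (fun x ↦ (t : ZMod 21) * x)) 3 4 = true := by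
  decide +kernel

set_option maxHeartbeats 0 in
/-- the search at `21`, first representatives `a ∈ [7, 21)`. Kernel. [folklore] -/
theorem check_21_7 : checkP 21 (fun s ↦ IsDecomposable s ∨ IsQuasiDecomposable s ∨ ∃ r ∈ residualReps_twentyOne, ∃ t ∈ unitsList 21, s = r.map (fun x ↦ (t : ZMod 21) * x)) 7 14 = true := by
  decide +kernel

/-- **Residual list at `m = 21` is complete**: every element of `I_{21}` is decomposable, quasi-decomposable, or a unit multiple of a listed representative. Kernel exhaustion, 3 chunks. [folklore] -/
theorem residual_twentyOne : ResidualWithin 21 residualReps_twentyOne :=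
  residualWithin_of_chunks 21 _ [(1, 2), (3, 4), (7, 14)] (by
    intro a h0 h1
    rcases Nat.lt_or_ge a 3 with hc0 | hc0
    · exact ⟨(1, 2), by simp, by omega, by omega⟩
    rcases Nat.lt_or_ge a 7 with hc1 | hc1
    · exact ⟨(3, 4), by simp, by omega, by omega⟩
    exact ⟨(7, 14), by simp, by omega, by omega⟩) (by
    intro p hp
    simp only [List.mem_cons, List.not_mem_nil, or_false] at hp
    rcases hp with rfl | rfl | rfl
    · exact check_21_1
    · exact check_21_3
    · exact check_21_7)

set_option maxHeartbeats 0 in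
/-- the representatives at `m = 21` lie in `I` and are neither decomposable nor quasi-decomposable. Kernel. [folklore] -/
theorem residualReps_twentyOne_spec :
    ∀ r ∈ residualReps_twentyOne, IsLevelOne r ∧ ¬ IsDecomposable r ∧ ¬ IsQuasiDecomposable r := by
  decide +kernel

end Summit.HodgeConjecture.FermatCycles.ThreefoldResidualA
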